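/-
Origin: expansion seat `planner-pub-hodgecm-landherr-g8-0`, handover #1 2026-08-18T07:16:28Z (`HOME/pub-hodgecm-landherr-g8/lean/LandherrG8/HermSpace3Classification.lean`, md5 6d76821f, 370 lines);
landed by the gen-7 packager in gate run 25 as `HodgeCM/Proofs/LandherrHermSpace3.lean` (import ^import LandherrG7\.→import HodgeCM.Proofs. ×1).
-/
/-
Copyright: pub-hodgecm formalisation cell (harness21, 2026). New file (not vendored).
Origin: HOME/pub-hodgecm-landherr-g8/lean/LandherrG8/HermSpace3Classification.lean — session
planner-pub-hodgecm-landherr-g8-0 (unit pub-hodgecm-landherr-g8, EXPANSION part (c) `Lemma33bLandherr`, gen 8).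
Intended final place: `HodgeCM/Proofs/LandherrHermSpace3.lean` (additive leaf; imports only landed modules and
`HodgeCM.Proofs.LandherrMatrix` (run 25); nothing in the package depends on it).
-/
import Summits.HodgeConjecture.HodgeCM.Proofs.LandherrMatrix_2
import Summits.HodgeConjecture.HodgeCM.CM.Basic
import Mathlib.Analysis.Matrix.PosDef

set_option autoImplicit false

/-!
# Landherr's theorem for PerL's hermitian 3-spaces `(V₃, h)`: classification by the discriminant

`HodgeCM.HermSpace3 L ι₁` (`HodgeCM/CM/Basic.lean`) is the package's type of the hermitian 3-spaces `(V₃, h)` over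
the CM field `L` of PerL v5 Thm 4.4 / §1.3 (and of the face setting): a Gram matrix `Hm ∈ M₃(L)`, hermitian for
complex conjugation `σ = conjRingHomK L`, of signature `(2,1)` at the place of `ι₁` (a Sylvester matrix
`T ∈ GL₃(ℂ)` with `Tᴴ · ι₁(Hm) · T = diag(1,1,-1)`) and positive definite at every complex embedding off that place.
PerL quantifies over ALL such spaces ("`(V₃,h)` any"); `Universe.LandherrExists` (PROVED, `Proofs/Landherr.lean`,
gen 3) says that one exists.  This file CLASSIFIES them — a corollary of Landherr's theorem for hermitian matrices
of arbitrary rank, `HodgeCM.landherr_hermitian_iff` (`Proofs/LandherrMatrix.lean`, gen 7):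

* §1 `HermSpace3.cT_Hm`, `det_ne_zero`, `det_isReal`, `det_re_neg_ι₁`, `det_re_pos_of_ne`: the discriminant
  `det Hm` is a non-zero element of `L₀ = L^σ`, NEGATIVE at the real place under `ι₁` (from `det diag(1,1,-1) = -1`)
  and POSITIVE at every other real place (a positive definite matrix has positive determinant) —
  `HermSpace3.admissibleDisc_det`;
* §2 `HermSpace3.posIndex_eq`: at a complex embedding `τ` the hermitian complex matrix `τ(Hm)` has exactly `2`
  positive eigenvalues if `τ` lies over the place of `ι₁` (`τ = ι₁` or `τ = ι₁ ∘ σ`) and `3` otherwise (Sylvester's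
  law of inertia over `ℂ`, `card_pos_eigenvalues_of_congr`, from `LandherrRankN.card_pos_le_of_congr`) — so ANY two
  `V V' : HermSpace3 L ι₁` have the same signature at every place;
* §3 **`HermSpace3.isometric_iff_det`** (Landherr for `(V₃,h)`): the Gram matrices of `V V' : HermSpace3 L ι₁` are
  congruent over `L` (`ᵗ(σg) · V.Hm · g = V'.Hm` for some `g ∈ GL₃(L)`, i.e. `(V₃,h) ≅ (V₃',h')` as hermitian spaces)
  **iff** `det V.Hm = det V'.Hm · z σ(z)` for some `z ∈ L^×` (equality in `L₀^× / N_{L/L₀}(L^×)`);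
* §4 **`HermSpace3.exists_det_eq`** (realisation of the invariant): every `d ∈ L₀^×` that is negative at the place of
  `ι₁` and positive at the other real places is the discriminant of some `(V₃,h)`, namely of `h = ⟨1, 1, d⟩`;
* §5 `HermSpace3.classification`: the three statements together — `(V₃,h) ↦ det h` induces a bijection from the
  isometry classes of hermitian 3-spaces of PerL's signature onto the classes modulo `N_{L/L₀}(L^×)` of the
  admissible discriminants `AdmissibleDisc L ι₁` (`d ∈ L₀^×` with signs `(-, +, …, +)`; these classes are well
  defined: `AdmissibleDisc.mul_norm`).

This is Landherr's theorem [La36] (Shimura, *Arithmetic of hermitian forms*, Doc. Math. 13 (2008) Thm 2.2 p. 748: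
"The isomorphism class of `(V, φ)` is determined by `n`, `{σ_v}` and `d₀(φ)`") specialised to the spaces of PerL,
where `n = 3` and the signatures `{σ_v}` are fixed by the type.  Pure proof: nothing is cited or posited; the
closure of every theorem is the standard trio.
-/

noncomputable section

open scoped Matrix ComplexOrder
open NumberField
open Literature.AlgebraicGeometry.ShimuraVarieties

namespace HodgeCM

namespace HermSpace3

variable {L : CMField} {ι₁ : L →+* ℂ}

/-! ## §1. The Gram matrix: hermitian, non-degenerate; the discriminant and its signs -/

/-- The Gram matrix is `σ`-hermitian in matrix form: `ᵗ(σ Hm) = Hm`. -/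
theorem cT_Hm (V : HermSpace3 L ι₁) : V.Hm.transpose.map (conjRingHomK L) = V.Hm := by
  ext i j
  simp only [Matrix.map_apply, Matrix.transpose_apply]
  exact V.isHermitian j i

/-- `τ(Hm)` is a hermitian complex matrix, at every complex embedding `τ` of `L`. -/
theorem isHermitian_map (V : HermSpace3 L ι₁) (τ : L →+* ℂ) : (V.Hm.map τ).IsHermitian :=
  LandherrRankN.isHermitian_map L V.cT_Hm τ

/-- `det diag(1, 1, -1) = -1`. -/
theorem det_signatureMatrix_two : (signatureMatrix 2).det = -1 := by
  unfold signatureMatrix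
  rw [Matrix.det_diagonal, Fin.prod_univ_three]
  simp [Fin.ext_iff]

/-- At `ι₁`: `ι₁(det Hm) · t = -1` with `t = |det T|² > 0` for a Sylvester matrix `T`. -/
theorem exists_det_map_ι₁_mul_eq (V : HermSpace3 L ι₁) : ∃ t : ℝ, 0 < t ∧ ι₁ V.Hm.det * (t : ℂ) = -1 := by
  obtain ⟨T, hT⟩ := V.signature_ι₁
  have hTu : IsUnit (T : Matrix (Fin 3) (Fin 3) ℂ).det :=
    (Matrix.isUnit_iff_isUnit_det _).mp (Units.isUnit T)
  have h := congrArg Matrix.det hT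
  rw [Matrix.det_mul, Matrix.det_mul, Matrix.det_conjTranspose, det_signatureMatrix_two,
    ← RingHom.mapMatrix_apply, ← RingHom.map_det] at h
  refine ⟨‖(T : Matrix (Fin 3) (Fin 3) ℂ).det‖ ^ 2, pow_pos (norm_pos_iff.mpr hTu.ne_zero) 2, ?_⟩
  rw [← h, Complex.star_def]
  push_cast
  rw [← Complex.conj_mul']
  ring

/-- The Gram matrix is non-degenerate. -/
theorem det_ne_zero (V : HermSpace3 L ι₁) : V.Hm.det ≠ 0 := by
  obtain ⟨t, -, h⟩ := V.exists_det_map_ι₁_mul_eq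
  intro h0
  rw [h0, map_zero, zero_mul] at h
  norm_num at h

/-- The discriminant `det Hm` lies in `L₀ = L^σ`. -/
theorem det_isReal (V : HermSpace3 L ι₁) : conjRingHomK L V.Hm.det = V.Hm.det := by
  have h := LandherrRankN.det_cT L V.Hm
  rwa [show LandherrRankN.cT L V.Hm = V.Hm from V.cT_Hm, eq_comm] at h

/-- The discriminant is NEGATIVE at `ι₁` (signature `(2,1)`: `det diag(1,1,-1) < 0`). -/
theorem det_re_neg_ι₁ (V : HermSpace3 L ι₁) : (ι₁ V.Hm.det).re < 0 := by
  obtain ⟨t, ht, h⟩ := V.exists_det_map_ι₁_mul_eq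
  have hre := congrArg Complex.re h
  simp only [Complex.mul_re, Complex.ofReal_re, Complex.ofReal_im, mul_zero, sub_zero, Complex.neg_re,
    Complex.one_re] at hre
  nlinarith

/-- The discriminant is POSITIVE at every complex embedding off the place of `ι₁` (positive definiteness). -/
theorem det_re_pos_of_ne (V : HermSpace3 L ι₁) (τ : L →+* ℂ)
    (hτ : InfinitePlace.mk τ ≠ InfinitePlace.mk ι₁) : 0 < (τ V.Hm.det).re := by
  have h := (V.posDef_of_ne τ hτ).det_pos
  rw [← RingHom.mapMatrix_apply, ← RingHom.map_det] at h
  simpa using (Complex.lt_def.mp h).1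

/-! ## §2. The signatures: the positive index of `τ(Hm)` is `2` over the place of `ι₁` and `3` elsewhere -/

/-- **Sylvester's law of inertia over `ℂ`, eigenvalue form.**  If `Tᴴ · A · T = diag s` with `T` invertible, the
number of positive eigenvalues (`Matrix.IsHermitian.eigenvalues`, Mathlib's spectral theorem) of the hermitian
complex matrix `A` equals the number of indices `i` with `Re (s i) > 0`. -/
theorem card_pos_eigenvalues_of_congr {ι : Type} [Fintype ι] [DecidableEq ι] {A T : Matrix ι ι ℂ}
    (hA : A.IsHermitian) (hT : IsUnit T.det) {s : ι → ℂ} (e : Tᴴ * A * T = Matrix.diagonal s) :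
    (Finset.univ.filter fun i => 0 < hA.eigenvalues i).card =
      (Finset.univ.filter fun i => 0 < (s i).re).card := by
  set U : Matrix ι ι ℂ := (hA.eigenvectorUnitary : Matrix ι ι ℂ) with hUdef
  set D : Matrix ι ι ℂ := Matrix.diagonal (RCLike.ofReal ∘ hA.eigenvalues) with hDdef
  -- the spectral theorem: `Uᴴ A U = D`, `U Uᴴ = 1`
  have hU : Uᴴ * A * U = D := by
    have h := hA.conjStarAlgAut_star_eigenvectorUnitary
    rw [Unitary.conjStarAlgAut_star_apply, Matrix.star_eq_conjTranspose] at h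
    exact h
  have hUU : U * Uᴴ = 1 := by
    have h := Unitary.coe_mul_star_self hA.eigenvectorUnitary
    rwa [Unitary.coe_star, Matrix.star_eq_conjTranspose] at h
  have hAeq : U * D * Uᴴ = A := by
    rw [← hU]
    calc U * (Uᴴ * A * U) * Uᴴ = (U * Uᴴ) * A * (U * Uᴴ) := by simp only [Matrix.mul_assoc]
      _ = A := by rw [hUU, Matrix.one_mul, Matrix.mul_one]
  apply le_antisymm
  · -- `#pos eigenvalues ≤ #pos s`: `(T⁻¹ U)ᴴ · diag s · (T⁻¹ U) = D`
    have hW1 : T * T⁻¹ = 1 := Matrix.mul_nonsing_inv T hT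
    have hWc : T⁻¹ᴴ * Tᴴ = 1 := by rw [← Matrix.conjTranspose_mul, hW1, Matrix.conjTranspose_one]
    have h2 : (T⁻¹ * U)ᴴ * Matrix.diagonal s * (T⁻¹ * U) = D := by
      rw [← e, Matrix.conjTranspose_mul]
      calc Uᴴ * T⁻¹ᴴ * (Tᴴ * A * T) * (T⁻¹ * U) = Uᴴ * (T⁻¹ᴴ * Tᴴ) * A * (T * T⁻¹) * U := by
            simp only [Matrix.mul_assoc]
        _ = D := by rw [hWc, hW1, Matrix.mul_one, Matrix.mul_one, hU]
    have h := LandherrRankN.card_pos_le_of_congr h2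
    rwa [LandherrRankN.card_pos_re_ofReal] at h
  · -- `#pos s ≤ #pos eigenvalues`: `(Uᴴ T)ᴴ · D · (Uᴴ T) = diag s`
    have h1 : (Uᴴ * T)ᴴ * D * (Uᴴ * T) = Matrix.diagonal s := by
      rw [Matrix.conjTranspose_mul, Matrix.conjTranspose_conjTranspose, ← e, ← hAeq]
      simp only [Matrix.mul_assoc]
    have h := LandherrRankN.card_pos_le_of_congr h1
    rwa [LandherrRankN.card_pos_re_ofReal] at h

/-- `diag(1, 1, -1)` has exactly two positive entries. -/
theorem card_pos_signature_two :
    (Finset.univ.filter fun i : Fin 3 => 0 < ((if i = Fin.last 2 then (-1 : ℂ) else 1)).re).card = 2 := by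
  have h : (Finset.univ.filter fun i : Fin 3 => 0 < ((if i = Fin.last 2 then (-1 : ℂ) else 1)).re) = {0, 1} := by
    ext i
    fin_cases i <;> simp [Fin.ext_iff]
  rw [h]
  rfl

/-- Signature `(2,1)` at `ι₁`: the hermitian matrix `ι₁(Hm)` has exactly two positive eigenvalues. -/
theorem posIndex_ι₁ (V : HermSpace3 L ι₁) :
    (Finset.univ.filter fun i => 0 < (V.isHermitian_map ι₁).eigenvalues i).card = 2 := by
  obtain ⟨T, hT⟩ := V.signature_ι₁
  have hTu : IsUnit (T : Matrix (Fin 3) (Fin 3) ℂ).det :=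
    (Matrix.isUnit_iff_isUnit_det _).mp (Units.isUnit T)
  have e : (T : Matrix (Fin 3) (Fin 3) ℂ)ᴴ * V.Hm.map ι₁ * (T : Matrix (Fin 3) (Fin 3) ℂ) =
      Matrix.diagonal fun i => if i = Fin.last 2 then (-1 : ℂ) else 1 := hT
  rw [card_pos_eigenvalues_of_congr (V.isHermitian_map ι₁) hTu e]
  exact card_pos_signature_two

/-- Signature `(3,0)` off the place of `ι₁`: all three eigenvalues of `τ(Hm)` are positive. -/
theorem posIndex_of_ne (V : HermSpace3 L ι₁) (τ : L →+* ℂ) (hτ : InfinitePlace.mk τ ≠ InfinitePlace.mk ι₁) :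
    (Finset.univ.filter fun i => 0 < (V.isHermitian_map τ).eigenvalues i).card = 3 := by
  have h : ∀ i, 0 < (V.isHermitian_map τ).eigenvalues i := fun i => (V.posDef_of_ne τ hτ).eigenvalues_pos i
  rw [Finset.filter_true_of_mem fun i _ => h i, Finset.card_univ, Fintype.card_fin]

/-- The positive index of `τ(Hm)` depends only on the PLACE of `τ` (conjugate embeddings give conjugate, hence
isospectral, hermitian matrices; proved through a diagonalisation over `L`, whose real entries `τ(d i)` have
`Re τ(d i) = Re τ̄(d i)`). -/
theorem posIndex_eq_of_mk_eq (V : HermSpace3 L ι₁) {τ τ' : L →+* ℂ}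
    (h : InfinitePlace.mk τ = InfinitePlace.mk τ') :
    (Finset.univ.filter fun i => 0 < (V.isHermitian_map τ).eigenvalues i).card =
      (Finset.univ.filter fun i => 0 < (V.isHermitian_map τ').eigenvalues i).card := by
  obtain ⟨G, hG, d, -, -, e⟩ := LandherrRankN.exists_congr_diagonal L V.Hm V.cT_Hm V.det_ne_zero
  rw [LandherrRankN.card_pos_eigenvalues_eq_posCount L V.cT_Hm hG e τ,
    LandherrRankN.card_pos_eigenvalues_eq_posCount L V.cT_Hm hG e τ']
  unfold LandherrRankN.posCount
  congr 1
  ext i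
  simp only [Finset.mem_filter, Finset.mem_univ, true_and]
  rw [← LandherrRankN.re_embedding_mk τ (d i), ← LandherrRankN.re_embedding_mk τ' (d i), h]

open scoped Classical in
/-- **The signatures of `(V₃,h)`**: `τ(Hm)` has `2` positive eigenvalues if `τ` lies over the place of `ι₁`, and
`3` otherwise.  In particular any two `V V' : HermSpace3 L ι₁` have the same signature at every complex embedding. -/
theorem posIndex_eq (V : HermSpace3 L ι₁) (τ : L →+* ℂ) :
    (Finset.univ.filter fun i => 0 < (V.isHermitian_map τ).eigenvalues i).card =
      if InfinitePlace.mk τ = InfinitePlace.mk ι₁ then 2 else 3 := by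
  split_ifs with h
  · rw [V.posIndex_eq_of_mk_eq h, V.posIndex_ι₁]
  · exact V.posIndex_of_ne τ h

/-- (Ported verbatim from the HodgeCMPerL package; no docstring in the source.) -/
theorem posIndex_eq_posIndex (V V' : HermSpace3 L ι₁) (τ : L →+* ℂ) :
    (Finset.univ.filter fun i => 0 < (V.isHermitian_map τ).eigenvalues i).card =
      (Finset.univ.filter fun i => 0 < (V'.isHermitian_map τ).eigenvalues i).card := by
  classical
  rw [V.posIndex_eq τ, V'.posIndex_eq τ]

/-! ## §3. Landherr's theorem for `(V₃, h)`: isometric iff the discriminants agree modulo norms -/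

/-- **Landherr's theorem for PerL's hermitian 3-spaces.**  Two hermitian 3-spaces `(V₃,h), (V₃',h')` over the CM
field `L`, both of signature `(2,1)` at the place of `ι₁` and positive definite at the other places, are isometric
— their Gram matrices are congruent over `L`: `ᵗ(σg) · Hm · g = Hm'` for some `g ∈ GL₃(L)` — if and only if their
discriminants agree in `L₀^× / N_{L/L₀}(L^×)`: `det Hm = det Hm' · z σ(z)` for some `z ∈ L^×`.  (Landherr 1936;
Shimura, Doc. Math. 13 (2008) Thm 2.2 p. 748, with `n = 3` and all signatures fixed by the type; from
`HodgeCM.landherr_hermitian_iff` and §2.) -/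
theorem isometric_iff_det (V V' : HermSpace3 L ι₁) :
    (∃ g : GL (Fin 3) L, ((g : Matrix (Fin 3) (Fin 3) L).transpose.map (conjRingHomK L)) * V.Hm *
        (g : Matrix (Fin 3) (Fin 3) L) = V'.Hm) ↔
      ∃ z : L, z ≠ 0 ∧ V.Hm.det = V'.Hm.det * (z * conjRingHomK L z) := by
  rw [landherr_hermitian_iff L V.Hm V'.Hm V.cT_Hm V'.cT_Hm V.det_ne_zero V'.det_ne_zero]
  exact ⟨fun h => h.2, fun h => ⟨fun τ => posIndex_eq_posIndex V V' τ, h⟩⟩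

/-- One direction, stated on its own: isometric spaces have the same discriminant class. -/
theorem det_class_of_isometric (V V' : HermSpace3 L ι₁) (g : GL (Fin 3) L)
    (hg : ((g : Matrix (Fin 3) (Fin 3) L).transpose.map (conjRingHomK L)) * V.Hm *
        (g : Matrix (Fin 3) (Fin 3) L) = V'.Hm) :
    ∃ z : L, z ≠ 0 ∧ V.Hm.det = V'.Hm.det * (z * conjRingHomK L z) :=
  (isometric_iff_det V V').mp ⟨g, hg⟩

/-- The other direction, stated on its own: equal discriminant classes force an isometry. -/
theorem isometric_of_det_class (V V' : HermSpace3 L ι₁) {z : L} (hz : z ≠ 0)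
    (h : V.Hm.det = V'.Hm.det * (z * conjRingHomK L z)) :
    ∃ g : GL (Fin 3) L, ((g : Matrix (Fin 3) (Fin 3) L).transpose.map (conjRingHomK L)) * V.Hm *
        (g : Matrix (Fin 3) (Fin 3) L) = V'.Hm :=
  (isometric_iff_det V V').mpr ⟨z, hz, h⟩

/-- In particular two spaces with EQUAL discriminants are isometric. -/
theorem isometric_of_det_eq (V V' : HermSpace3 L ι₁) (h : V.Hm.det = V'.Hm.det) :
    ∃ g : GL (Fin 3) L, ((g : Matrix (Fin 3) (Fin 3) L).transpose.map (conjRingHomK L)) * V.Hm *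
        (g : Matrix (Fin 3) (Fin 3) L) = V'.Hm :=
  isometric_of_det_class V V' one_ne_zero (by rw [h, map_one, mul_one, mul_one])

/-! ## §4. Realisation of the invariant: every admissible discriminant occurs -/

/-- The **admissible discriminants** for PerL's signature `(2,1)` at `ι₁`, `(3,0)` elsewhere: the `d ∈ L₀ = L^σ`
that are negative at the place of `ι₁` and positive at every other real place of `L₀` (such a `d` is non-zero:
`AdmissibleDisc.ne_zero`). -/
def AdmissibleDisc (L : CMField) (ι₁ : L →+* ℂ) (d : L) : Prop :=
  conjRingHomK L d = d ∧ (ι₁ d).re < 0 ∧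
    ∀ τ : L →+* ℂ, InfinitePlace.mk τ ≠ InfinitePlace.mk ι₁ → 0 < (τ d).re

/-- (Ported verbatim from the HodgeCMPerL package; no docstring in the source.) -/
theorem AdmissibleDisc.ne_zero {d : L} (h : AdmissibleDisc L ι₁ d) : d ≠ 0 := by
  rintro rfl
  have := h.2.1
  simp at this

/-- Admissibility is a property of the class modulo norms: `N_{L/L₀}(z) = z σ(z)` is totally positive. -/
theorem AdmissibleDisc.mul_norm {d z : L} (h : AdmissibleDisc L ι₁ d) (hz : z ≠ 0) :
    AdmissibleDisc L ι₁ (d * (z * conjRingHomK L z)) := by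
  obtain ⟨hd, hneg, hpos⟩ := h
  have hzz : ∀ τ : L →+* ℂ, τ (z * conjRingHomK L z) = ((‖τ z‖ ^ 2 : ℝ) : ℂ) := fun τ =>
    embedding_mul_conjRingHomK L τ z
  have hzpos : ∀ τ : L →+* ℂ, 0 < ‖τ z‖ ^ 2 := fun τ =>
    pow_pos (norm_pos_iff.mpr ((map_ne_zero τ).mpr hz)) 2
  refine ⟨?_, ?_, fun τ hτ => ?_⟩
  · rw [map_mul, map_mul, hd, conjRingHomK_conjRingHomK, mul_comm (conjRingHomK L z) z]
  · rw [map_mul, hzz, Complex.re_mul_ofReal]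
    exact mul_neg_of_neg_of_pos hneg (hzpos ι₁)
  · rw [map_mul, hzz, Complex.re_mul_ofReal]
    exact mul_pos (hpos τ hτ) (hzpos τ)

/-- **The discriminant of a `(V₃,h)` is admissible** (§1 collected). -/
theorem admissibleDisc_det (V : HermSpace3 L ι₁) : AdmissibleDisc L ι₁ V.Hm.det :=
  ⟨V.det_isReal, V.det_re_neg_ι₁, V.det_re_pos_of_ne⟩

/-- `det diag(1, 1, d) = d`. -/
theorem det_diagonal_one_one (d : L) : (Matrix.diagonal ![(1 : L), 1, d]).det = d := by
  rw [Matrix.det_diagonal, Fin.prod_univ_three]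
  simp

/-- **The space `⟨1, 1, d⟩`.**  For an admissible discriminant `d` the diagonal form `h = ⟨1, 1, d⟩` is a hermitian
3-space of PerL's signature (the construction of `landherr_exists_proof`, `Proofs/Landherr.lean`, for a general `d`:
Sylvester matrix `T = diag(1, 1, 1/√(-ι₁ d))` at `ι₁`, `Matrix.PosDef.diagonal` elsewhere). -/
theorem exists_Hm_eq_diagonal {d : L} (h : AdmissibleDisc L ι₁ d) :
    ∃ V : HermSpace3 L ι₁, V.Hm = Matrix.diagonal ![1, 1, d] := by
  obtain ⟨hd, hneg, hpos⟩ := h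
  set r : ℝ := (ι₁ d).re with hrdef
  have hr : ι₁ d = (r : ℂ) := Lemma33bLandherrProof.embedding_eq_re L hd ι₁
  refine ⟨{ Hm := Matrix.diagonal ![1, 1, d], isHermitian := ?_, signature_ι₁ := ?_, posDef_of_ne := ?_ }, rfl⟩
  · intro i j
    fin_cases i <;> fin_cases j <;> simp [Matrix.diagonal, hd]
  · -- Sylvester at `ι₁`: `T = diag(1, 1, 1/√(-r))`, `Tᴴ · diag(1,1,r) · T = diag(1,1,-1) = signatureMatrix 2`
    have hmap : (Matrix.diagonal ![(1 : L), 1, d]).map ι₁ = Matrix.diagonal ![(1 : ℂ), 1, (r : ℂ)] := by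
      rw [Matrix.diagonal_map (map_zero ι₁)]
      congr 1; funext i; fin_cases i <;> simp [hr]
    set c : ℝ := (Real.sqrt (-r))⁻¹ with hc
    have hsq : Real.sqrt (-r) ^ 2 = -r := Real.sq_sqrt (by linarith)
    have hsqrt_pos : 0 < Real.sqrt (-r) := Real.sqrt_pos.mpr (by linarith)
    have hc0 : c ≠ 0 := inv_ne_zero hsqrt_pos.ne'
    have hcrc : (c : ℂ) * (r : ℂ) * (c : ℂ) = -1 := by
      have : c * r * c = -1 := by
        rw [hc]; field_simp; nlinarith [hsq]
      exact_mod_cast this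
    let T : Matrix (Fin 3) (Fin 3) ℂ := Matrix.diagonal ![(1 : ℂ), 1, (c : ℂ)]
    have hdet : T.det ≠ 0 := by
      simp [T, Matrix.det_diagonal, Fin.prod_univ_three, hc0]
    refine ⟨Matrix.GeneralLinearGroup.mkOfDetNeZero T hdet, ?_⟩
    rw [Matrix.GeneralLinearGroup.val_mkOfDetNeZero, hmap]
    simp only [T, Matrix.diagonal_conjTranspose, Matrix.diagonal_mul_diagonal]
    unfold signatureMatrix
    congr 1; funext i
    fin_cases i <;> simp [Fin.last, hcrc]
  · intro τ hτ
    set s : ℝ := (τ d).re with hsdef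
    have hs : τ d = (s : ℂ) := Lemma33bLandherrProof.embedding_eq_re L hd τ
    have hs0 : 0 < s := hpos τ hτ
    have hmap : (Matrix.diagonal ![(1 : L), 1, d]).map τ = Matrix.diagonal ![(1 : ℂ), 1, (s : ℂ)] := by
      rw [Matrix.diagonal_map (map_zero τ)]
      congr 1; funext i; fin_cases i <;> simp [hs]
    rw [hmap]
    apply Matrix.PosDef.diagonal
    intro i
    fin_cases i <;> simp [Complex.zero_lt_real, hs0]

/-- **Realisation of the invariant.**  Every admissible discriminant is the discriminant of a hermitian 3-space of
PerL's signature. -/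
theorem exists_det_eq {d : L} (h : AdmissibleDisc L ι₁ d) : ∃ V : HermSpace3 L ι₁, V.Hm.det = d := by
  obtain ⟨V, hV⟩ := exists_Hm_eq_diagonal h
  exact ⟨V, by rw [hV, det_diagonal_one_one]⟩

/-- Every `(V₃,h)` is isometric to a DIAGONAL space `⟨1, 1, det h⟩`. -/
theorem exists_isometric_diagonal (V : HermSpace3 L ι₁) :
    ∃ V' : HermSpace3 L ι₁, V'.Hm = Matrix.diagonal ![1, 1, V.Hm.det] ∧
      ∃ g : GL (Fin 3) L, ((g : Matrix (Fin 3) (Fin 3) L).transpose.map (conjRingHomK L)) * V.Hm *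
        (g : Matrix (Fin 3) (Fin 3) L) = V'.Hm := by
  obtain ⟨V', hV'⟩ := exists_Hm_eq_diagonal V.admissibleDisc_det
  exact ⟨V', hV', isometric_of_det_eq V V' (by rw [hV', det_diagonal_one_one])⟩

/-! ## §5. The classification, collected -/

/-- **Classification of PerL's hermitian 3-spaces** (Landherr).  Over a CM field `L` with a distinguished complex
embedding `ι₁`: (1) the discriminant of every `(V₃,h)` of signature `(2,1)` at the place of `ι₁` and `(3,0)`
elsewhere is an admissible discriminant; (2) every admissible discriminant occurs; (3) two such spaces are
isometric iff their discriminants agree modulo `N_{L/L₀}(L^×)`.  So `(V₃,h) ↦ [det h]` is a bijection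
{isometry classes} → {admissible `d`} / norms. -/
theorem classification (L : CMField) (ι₁ : L →+* ℂ) :
    (∀ V : HermSpace3 L ι₁, AdmissibleDisc L ι₁ V.Hm.det) ∧
    (∀ d : L, AdmissibleDisc L ι₁ d → ∃ V : HermSpace3 L ι₁, V.Hm.det = d) ∧
    (∀ V V' : HermSpace3 L ι₁,
      (∃ g : GL (Fin 3) L, ((g : Matrix (Fin 3) (Fin 3) L).transpose.map (conjRingHomK L)) * V.Hm *
          (g : Matrix (Fin 3) (Fin 3) L) = V'.Hm) ↔
        ∃ z : L, z ≠ 0 ∧ V.Hm.det = V'.Hm.det * (z * conjRingHomK L z)) :=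
  ⟨admissibleDisc_det, fun _ h => exists_det_eq h, isometric_iff_det⟩

end HermSpace3

end HodgeCM

end
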